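import Summits.AtomisticToContinuum.Crystallization.Theorems.SlackRigidity.Negative.WitnessBasics
import Literature.MathematicalPhysics.StatisticalMechanics.LennardJonesClusters
import Literature.MathematicalPhysics.StatisticalMechanics.LennardJonesThermodynamicLimitProofs
import HarnessLib

/-!
# Line `c-layer-witness-strictness` (crux `SlackRigidity`, stmt-AtomisticToContinuum-11960): thinning of near-minimisers

Stub `stub_thinning` of the line skeleton: there is `K > 0` (here `K = 729·229/12`) such that
every injective Lennard-Jones configuration `x` of `N` points in `ℝ³` contains a `1/3`-separated
sub-configuration `y` of `M ≤ N` of its points with `𝓔(y) ≤ 𝓔(x)` and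
`K·(N − M) ≤ 𝓔(x) − E(N)`: the deletions are paid out of the energy excess (the finite-`N`,
excess-paying analogue of the tree's `LennardJonesMinimalDistance_holds`; Blanc–Lewin 2015 §2.2,
Xue 1997 for the qualitative content).

Proof (induction on `N`, all ingredients in the tree).  If `x` is already `1/3`-separated take
`y = x` (`groundStateEnergy_lennardJones_le`).  Otherwise pick a closest pair `(i₀, j₀)`,
`r = |x_{i₀} − x_{j₀}| < 1/3`; all mutual distances are `≥ r`, so by the shell sum
`sum_inv_pow_six_le` (`∑_{k ≠ i₀} |x_{i₀} − x_k|⁻⁶ ≤ 250 r⁻⁶`) the site energy of `i₀` is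
`≥ r⁻¹²/12 − (250/6) r⁻⁶ = u(u − 500)/12 ≥ 729·229/12 = K` with `u = r⁻⁶ > 729` (the computation
of `LennardJonesMinimalDistance_holds`).  Remove `i₀`: by the removal identity
`interactionEnergy_eq_succAbove_add_siteEnergy` the energy drops by that site energy, hence by at
least `K`; apply the induction hypothesis to the remaining `N − 1` points and use that
`N ↦ E(N)` is non-increasing (`subadditive_groundStateEnergy_lennardJones` with `E(1) = 0`,
`groundStateEnergy_of_le_one`).  All `[folklore]`.
-/

noncomputable section

namespace Summit.AtomisticToContinuum.Crystallization.Theorems.CLayerWitnessThinning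

open scoped BigOperators
open Literature.MathematicalPhysics.StatisticalMechanics
open Summit.AtomisticToContinuum.Crystallization.Theorems.SlackRigidityNegative (E3)

/-- `N ↦ E(N)` is non-increasing for Lennard-Jones in `ℝ³`: `E(N + 1) ≤ E(N) + E(1) = E(N)` by
subadditivity (`subadditive_groundStateEnergy_lennardJones`) and `E(1) = 0`
(`groundStateEnergy_of_le_one`). [folklore] -/
theorem groundStateEnergy_succ_le (N : ℕ) :
    groundStateEnergy lennardJones 3 (N + 1) ≤ groundStateEnergy lennardJones 3 N := by
  have h : groundStateEnergy lennardJones 3 (N + 1) ≤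
      groundStateEnergy lennardJones 3 N + groundStateEnergy lennardJones 3 1 :=
    subadditive_groundStateEnergy_lennardJones (d := 3) (by norm_num) N 1
  rwa [groundStateEnergy_of_le_one lennardJones le_rfl, add_zero] at h

/-- **A deletable particle.** If an injective configuration `x` in `ℝ³` has two points at
distance `< 1/3`, then some particle `i₀` (a member of a closest pair `(i₀, j₀)`,
`r = |x_{i₀} − x_{j₀}| < 1/3`) has Lennard-Jones site energy `≥ 729·229/12`: all mutual
distances are `≥ r`, so `𝓔^{i₀}(x) ≥ r⁻¹²/12 − (250/6) r⁻⁶` by the shell sum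
`sum_inv_pow_six_le`, and `u² − 500u − 729·229 = (u − 729)(u + 229) ≥ 0` for
`u = r⁻⁶ > 3⁶ = 729`. [folklore] -/
theorem exists_le_siteEnergy_of_dist_lt {N : ℕ} {x : Fin N → E3} (hx : Function.Injective x)
    {i j : Fin N} (hij : i ≠ j) (hlt : dist (x i) (x j) < 1 / 3) :
    ∃ i₀ : Fin N, (729 * 229 / 12 : ℝ) ≤ siteEnergy lennardJones x i₀ := by
  -- a closest pair `(i₀, j₀)`
  obtain ⟨p, hp, hmin⟩ := Finset.exists_min_image Finset.univ.offDiag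
    (fun p : Fin N × Fin N => dist (x p.1) (x p.2)) ⟨(i, j), by simp [hij]⟩
  obtain ⟨i₀, j₀⟩ := p
  have hij₀ : i₀ ≠ j₀ := by simpa using hp
  set r := dist (x i₀) (x j₀) with hr_def
  have hr : 0 < r := dist_pos.2 (hx.ne hij₀)
  have hsep : ∀ k l, k ≠ l → r ≤ dist (x k) (x l) := fun k l hkl => hmin (k, l) (by simp [hkl])
  have hr3 : r < 1 / 3 := (hsep i j hij).trans_lt hlt
  refine ⟨i₀, ?_⟩
  -- the site energy of `i₀`
  have hS := sum_inv_pow_six_le x hr hsep i₀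
  have h12 : r⁻¹ ^ 12 ≤ ∑ k ∈ Finset.univ.erase i₀, (dist (x i₀) (x k))⁻¹ ^ 12 := by
    have hj : j₀ ∈ Finset.univ.erase i₀ := Finset.mem_erase.2 ⟨hij₀.symm, Finset.mem_univ _⟩
    exact Finset.single_le_sum (f := fun k => (dist (x i₀) (x k))⁻¹ ^ 12)
      (fun k _ => by positivity) hj
  have hexp : siteEnergy lennardJones x i₀ =
      (1 / 12) * ∑ k ∈ Finset.univ.erase i₀, (dist (x i₀) (x k))⁻¹ ^ 12 -
        (1 / 6) * ∑ k ∈ Finset.univ.erase i₀, (dist (x i₀) (x k))⁻¹ ^ 6 := by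
    simp only [siteEnergy, lennardJones, Finset.sum_sub_distrib, Finset.mul_sum]
  have hu : (729 : ℝ) < r⁻¹ ^ 6 := by
    have h3 : 3 < r⁻¹ := by
      rw [lt_inv_comm₀ (by norm_num) hr]
      have : (3 : ℝ)⁻¹ = 1 / 3 := by norm_num
      linarith
    calc (729 : ℝ) = 3 ^ 6 := by norm_num
      _ < r⁻¹ ^ 6 := pow_lt_pow_left₀ h3 (by norm_num) (by norm_num)
  have h12' : r⁻¹ ^ 12 = (r⁻¹ ^ 6) ^ 2 := by ring
  rw [h12'] at h12
  have hkey : (729 * 229 : ℝ) ≤ (r⁻¹ ^ 6) ^ 2 - 500 * r⁻¹ ^ 6 := by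
    have h229 : (0 : ℝ) ≤ r⁻¹ ^ 6 + 229 := by positivity
    nlinarith [mul_nonneg (sub_pos.2 hu).le h229]
  rw [hexp]
  linarith [h12, hS, hkey]

/-- **Stub 2 — thinning of near-minimisers (Lennard-Jones specific, certificate-free).**
There is `K > 0` (`K = 729·229/12`) such that every injective configuration `x` of `N` points of
`ℝ³` contains a `1/3`-SEPARATED sub-configuration `y` of `M ≤ N` of its points with no larger
Lennard-Jones energy and `K·(N − M) ≤ 𝓔(x) − E(N)`: the deletions are paid out of the excess.
Induction on `N`: while two points are closer than `1/3`, delete a particle of a closest pair —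
its site energy is `≥ K` (`exists_le_siteEnergy_of_dist_lt`), so the energy drops by `≥ K`
(`interactionEnergy_eq_succAbove_add_siteEnergy`), while `E(N − 1) ≥ E(N)`
(`groundStateEnergy_succ_le`); a separated configuration is its own thinning since
`E(N) ≤ 𝓔(x)` (`groundStateEnergy_lennardJones_le`). [folklore] -/
theorem stub_thinning :
    ∃ K : ℝ, 0 < K ∧ ∀ (N : ℕ) (x : Fin N → E3), Function.Injective x →
      ∃ (M : ℕ) (y : Fin M → E3), Function.Injective y ∧ Set.range y ⊆ Set.range x ∧
        (∀ i j : Fin M, i ≠ j → (1 / 3 : ℝ) ≤ dist (y i) (y j)) ∧ M ≤ N ∧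
        K * ((N : ℝ) - M) ≤ interactionEnergy lennardJones x - groundStateEnergy lennardJones 3 N ∧
        interactionEnergy lennardJones y ≤ interactionEnergy lennardJones x := by
  refine ⟨729 * 229 / 12, by norm_num, ?_⟩
  -- a separated configuration is its own thinning
  have hsepCase : ∀ (N : ℕ) (x : Fin N → E3), Function.Injective x →
      (∀ i j : Fin N, i ≠ j → (1 / 3 : ℝ) ≤ dist (x i) (x j)) →
      ∃ (M : ℕ) (y : Fin M → E3), Function.Injective y ∧ Set.range y ⊆ Set.range x ∧
        (∀ i j : Fin M, i ≠ j → (1 / 3 : ℝ) ≤ dist (y i) (y j)) ∧ M ≤ N ∧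
        (729 * 229 / 12 : ℝ) * ((N : ℝ) - M) ≤
          interactionEnergy lennardJones x - groundStateEnergy lennardJones 3 N ∧
        interactionEnergy lennardJones y ≤ interactionEnergy lennardJones x := by
    intro N x hx hsep
    refine ⟨N, x, hx, subset_rfl, hsep, le_rfl, ?_, le_rfl⟩
    rw [sub_self, mul_zero, sub_nonneg]
    exact groundStateEnergy_lennardJones_le hx
  intro N
  induction N with
  | zero =>
    intro x hx
    exact hsepCase 0 x hx fun i => i.elim0
  | succ n ih =>
    intro x hx
    by_cases hsep : ∀ i j : Fin (n + 1), i ≠ j → (1 / 3 : ℝ) ≤ dist (x i) (x j)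
    · exact hsepCase (n + 1) x hx hsep
    push Not at hsep
    obtain ⟨i, j, hij, hlt⟩ := hsep
    -- delete a particle `i₀` of a closest pair: its site energy is `≥ K`
    obtain ⟨i₀, hi₀⟩ := exists_le_siteEnergy_of_dist_lt hx hij hlt
    have hx' : Function.Injective (x ∘ i₀.succAbove) := hx.comp Fin.succAbove_right_injective
    have hE : interactionEnergy lennardJones x =
        interactionEnergy lennardJones (x ∘ i₀.succAbove) + siteEnergy lennardJones x i₀ :=
      interactionEnergy_eq_succAbove_add_siteEnergy lennardJones lennardJones_zero x i₀
    have hmono := groundStateEnergy_succ_le n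
    -- thin the remaining `n` points
    obtain ⟨M, y, hy, hyx', hysep, hMn, hK, hEy⟩ := ih (x ∘ i₀.succAbove) hx'
    refine ⟨M, y, hy, hyx'.trans (Set.range_comp_subset_range _ _), hysep, hMn.trans n.le_succ,
      ?_, ?_⟩
    · push_cast
      linarith
    · linarith

end Summit.AtomisticToContinuum.Crystallization.Theorems.CLayerWitnessThinning

end
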